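import Literature.Barriers.CriticalPhenomena.PlaquetteWalkHoleRootAnyTripleOver
import Literature.Barriers.CriticalPhenomena.PlaquetteWalkHoleRootPortTripleBoxes
import HarnessLib

/-!
# Barrier catalogue (SAWScalingLimit): THREE DEFECTS DECIDE — five cells from the walls, three removed cells force `V ≡ 0` if they form a
port triple, and kill nothing otherwise

Leaf of `PlaquetteWalkHoleRootAnyTripleOver` (★ `lawL_box_anyTriple_not_killed`, `PortTriple`, `portTriples42`) and
`PlaquetteWalkHoleRootPortTripleBoxes` (`lawL_box_portTriple{S,N,W}_vertexFunctional_eq_zero`, `lawL_box_rootSealed_vertexFunctional_eq_zero`).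
Setting: the `m × n` box minus `S ∋ h`, hole `h`, root plaquette `(h.1 + 1, h.2)` rooted at `W`, far cell kept; reference coordinates
`c ↦ (c.1 − (h.1 − 3), c.2 − (h.2 − 2))` (hole `(3,2)`).

* ★★★★ `lawL_box_portTriple_vertexFunctional_eq_zero` — if three removed cells `c, d, e ∈ S` form a PORT TRIPLE in reference coordinates
  (the three outer neighbours of a far door, or `rootS, rootN, rootE`), the Yang–Baxter vertex functional with the printed weights vanishes
  at every `θ ∈ [π/3, 2π/3]` — in EVERY box and for every `S` (any further defects): a pigeonhole (`three distinct members exhaust a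
  three-element list`) feeds the four box theorems of `PlaquetteWalkHoleRootPortTripleBoxes`.
* ★★★★★ `lawL_box_threeDefects_decide` — THE DICHOTOMY: hole five cells from every wall, `S ⊆ {h, c, d, e}` ∋ `c, d, e` off the five forced
  cells: if `(c, d, e)` is a port triple then `V ≡ 0` on `[π/3, 2π/3]`, and if not then NONE of LAW L's four kill statements holds (both
  routes carry wound walks free in both honeycomb classes).

Not in print; venture lane «pcv-sawmu», seat b-step0 gen 30 (capstone of FINDING-YB-KILL-FORCED-ZEROS §28 add. 9–11).

References: A. Glazman, I. Manolescu, arXiv:1708.00395v3, §1 (Fig. 1, Fig. 2), §2.1, §4.2, Lemma 2.1 [GlazmanManolescu2019]; A. Glazman,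
Electron. Commun. Probab. 20 (2015) no. 86, Lemma 3.1, proof pp. 6–7 [Glazman2015WeightedSAW]; R. Courant, H. Robbins (1941/1958),
Ch. I §1 (counting) [CourantRobbins1958].
-/

noncomputable section

open Set Function Complex

namespace Literature.Barriers.CriticalPhenomena.PlaquetteWalk

open Literature.Probability.RandomPlanarGeometry.SAW.YangBaxter
open Real Complex

/-- Pigeonhole: three pairwise distinct members of a three-element list exhaust it. [cite: CourantRobbins1958, Ch. I §1 (counting finite sets)] -/
theorem eq_or_eq_or_eq_of_mem_triple_list {x y z p q r : Face} (hx : x ∈ [p, q, r]) (hy : y ∈ [p, q, r]) (hz : z ∈ [p, q, r])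
    (hxy : x ≠ y) (hyz : y ≠ z) (hxz : x ≠ z) : ∀ u ∈ [p, q, r], u = x ∨ u = y ∨ u = z := by
  intro u hu
  simp only [List.mem_cons, List.not_mem_nil, or_false] at hx hy hz hu
  rcases hx with rfl | rfl | rfl <;> rcases hy with rfl | rfl | rfl <;> rcases hz with rfl | rfl | rfl <;>
    first
    | exact absurd rfl hxy
    | exact absurd rfl hyz
    | exact absurd rfl hxz
    | (rcases hu with rfl | rfl | rfl <;> simp)

section Boxes

variable {m n : ℕ} {S : List Face} {h : Face}

/-- ★★★★ **A PORT TRIPLE REMOVED ⇒ `V ≡ 0`**, every box, any further defects: if `c, d, e ∈ S` are, in reference coordinates, three pairwise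
distinct cells of one of the four port triples `{(1,1),(2,0),(3,1)}`, `{(1,3),(2,4),(3,3)}`, `{(0,2),(1,1),(1,3)}`, `{(4,1),(4,3),(5,2)}`, then the
vertex functional with the printed weights vanishes on `[π/3, 2π/3]`.
[cite: GlazmanManolescu2019, Lemma 2.1 (statement, "in the form given in [Gl]"), §1 eq. (1), §2.1] [cite: Glazman2015WeightedSAW, Lemma 3.1 (proof, pp. 6–7)] -/
theorem lawL_box_portTriple_vertexFunctional_eq_zero (hW : 1 ≤ h.1) (hE : h.1 ≤ m) (hS0 : 0 ≤ h.2) (hN : h.2 + 1 ≤ n)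
    (hh : h ∈ S) (hfS : ((h.1 - 1, h.2) : Face) ∉ S) {c d e : Face}
    (hP : PortTriple (c.1 - (h.1 - 3), c.2 - (h.2 - 2)) (d.1 - (h.1 - 3), d.2 - (h.2 - 2)) (e.1 - (h.1 - 3), e.2 - (h.2 - 2)))
    (hc : c ∈ S) (hd : d ∈ S) (he : e ∈ S) {θ : ℝ} (hθ : θ ∈ Set.Icc (π / 3) (2 * π / 3)) :
    vertexFunctional (printedWeights θ) tFiveEighths (ybCoeff θ) (boxMinus m n S) (Face.side (h.1 + 1, h.2) .W)
      (farW (h.1 + 1, h.2)) = 0 := by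
  obtain ⟨hcd, hde, hce, T, hT, hcT, hdT, heT⟩ := hP
  -- every cell of `T`, shifted back to the box, is removed
  have key : ∀ T' : List Face, T' = T → ∀ p q r : Face, T' = [p, q, r] →
      ∀ u ∈ [p, q, r], ((u.1 + (h.1 - 3), u.2 + (h.2 - 2)) : Face) ∈ S := by
    rintro T' rfl p q r hT3 u hu
    rw [hT3] at hcT hdT heT
    rcases eq_or_eq_or_eq_of_mem_triple_list hcT hdT heT hcd hde hce u hu with rfl | rfl | rfl
    · have ec : ((c.1 - (h.1 - 3) + (h.1 - 3), c.2 - (h.2 - 2) + (h.2 - 2)) : Face) = c := Prod.ext (by simp only; ring) (by simp only; ring)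
      rw [ec]; exact hc
    · have ed : ((d.1 - (h.1 - 3) + (h.1 - 3), d.2 - (h.2 - 2) + (h.2 - 2)) : Face) = d := Prod.ext (by simp only; ring) (by simp only; ring)
      rw [ed]; exact hd
    · have ee : ((e.1 - (h.1 - 3) + (h.1 - 3), e.2 - (h.2 - 2) + (h.2 - 2)) : Face) = e := Prod.ext (by simp only; ring) (by simp only; ring)
      rw [ee]; exact he
  have mem : ∀ p q r : Face, T = [p, q, r] → ∀ u ∈ [p, q, r], ((u.1 + (h.1 - 3), u.2 + (h.2 - 2)) : Face) ∈ S :=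
    key T rfl
  simp only [portTriples42, List.mem_cons, List.not_mem_nil, or_false] at hT
  rcases hT with rfl | rfl | rfl | rfl
  · -- port triple of `farS`: (1,1) pocketSW, (2,0) farSWS, (3,1) holeS
    have m1 := mem _ _ _ rfl (1, 1) (by simp)
    have m2 := mem _ _ _ rfl (2, 0) (by simp)
    have m3 := mem _ _ _ rfl (3, 1) (by simp)
    have e1 : ((1 + (h.1 - 3), 1 + (h.2 - 2)) : Face) = (h.1 - 2, h.2 - 1) := Prod.ext (by simp only; ring) (by simp only; ring)
    have e2 : ((2 + (h.1 - 3), 0 + (h.2 - 2)) : Face) = (h.1 - 1, h.2 - 2) := Prod.ext (by simp only; ring) (by simp only; ring)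
    have e3 : ((3 + (h.1 - 3), 1 + (h.2 - 2)) : Face) = (h.1, h.2 - 1) := Prod.ext (by simp only; ring) (by simp only; ring)
    rw [e1] at m1; rw [e2] at m2; rw [e3] at m3
    exact lawL_box_portTripleS_vertexFunctional_eq_zero hW hE hS0 hN hh hfS m1 m2 m3 hθ
  · -- port triple of `farN`: (1,3) pocketNW, (2,4) farNWN, (3,3) holeN
    have m1 := mem _ _ _ rfl (1, 3) (by simp)
    have m2 := mem _ _ _ rfl (2, 4) (by simp)
    have m3 := mem _ _ _ rfl (3, 3) (by simp)
    have e1 : ((1 + (h.1 - 3), 3 + (h.2 - 2)) : Face) = (h.1 - 2, h.2 + 1) := Prod.ext (by simp only; ring) (by simp only; ring)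
    have e2 : ((2 + (h.1 - 3), 4 + (h.2 - 2)) : Face) = (h.1 - 1, h.2 + 2) := Prod.ext (by simp only; ring) (by simp only; ring)
    have e3 : ((3 + (h.1 - 3), 3 + (h.2 - 2)) : Face) = (h.1, h.2 + 1) := Prod.ext (by simp only; ring) (by simp only; ring)
    rw [e1] at m1; rw [e2] at m2; rw [e3] at m3
    exact lawL_box_portTripleN_vertexFunctional_eq_zero hW hE hS0 hN hh hfS m1 m2 m3 hθ
  · -- port triple of `farWW`: (0,2), (1,1) pocketSW, (1,3) pocketNW
    have m1 := mem _ _ _ rfl (0, 2) (by simp)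
    have m2 := mem _ _ _ rfl (1, 1) (by simp)
    have m3 := mem _ _ _ rfl (1, 3) (by simp)
    have e1 : ((0 + (h.1 - 3), 2 + (h.2 - 2)) : Face) = (h.1 - 3, h.2) := Prod.ext (by simp only; ring) (by simp only; ring)
    have e2 : ((1 + (h.1 - 3), 1 + (h.2 - 2)) : Face) = (h.1 - 2, h.2 - 1) := Prod.ext (by simp only; ring) (by simp only; ring)
    have e3 : ((1 + (h.1 - 3), 3 + (h.2 - 2)) : Face) = (h.1 - 2, h.2 + 1) := Prod.ext (by simp only; ring) (by simp only; ring)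
    rw [e1] at m1; rw [e2] at m2; rw [e3] at m3
    exact lawL_box_portTripleW_vertexFunctional_eq_zero hW hE hS0 hN hh hfS m1 m2 m3 hθ
  · -- the sealed root: (4,1) rootS, (4,3) rootN, (5,2) rootE
    have m1 := mem _ _ _ rfl (4, 1) (by simp)
    have m2 := mem _ _ _ rfl (4, 3) (by simp)
    have m3 := mem _ _ _ rfl (5, 2) (by simp)
    have e1 : ((4 + (h.1 - 3), 1 + (h.2 - 2)) : Face) = (h.1 + 1, h.2 - 1) := Prod.ext (by simp only; ring) (by simp only; ring)
    have e2 : ((4 + (h.1 - 3), 3 + (h.2 - 2)) : Face) = (h.1 + 1, h.2 + 1) := Prod.ext (by simp only; ring) (by simp only; ring)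
    have e3 : ((5 + (h.1 - 3), 2 + (h.2 - 2)) : Face) = (h.1 + 2, h.2) := Prod.ext (by simp only; ring) (by simp only; ring)
    rw [e1] at m1; rw [e2] at m2; rw [e3] at m3
    exact lawL_box_rootSealed_vertexFunctional_eq_zero hW hE hS0 hN hh hfS m1 m2 m3 hθ

/-- ★★★★★ **THREE DEFECTS DECIDE.** Hole five cells from every wall; `c, d, e ∈ S` three removed cells other than the five forced cells, and
`S ⊆ {h, c, d, e}`. If `(c, d, e)` is a port triple (reference coordinates), the vertex functional with the printed weights vanishes on
`[π/3, 2π/3]`; if it is not, NONE of LAW L's four kill statements holds at any `θ` (`lawL_box_anyTriple_not_killed`).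
[cite: GlazmanManolescu2019, Lemma 2.1 (statement, "in the form given in [Gl]"), §1 eq. (1), §2.1, §4.2] [cite: Glazman2015WeightedSAW, Lemma 3.1 (proof, pp. 6–7)] -/
theorem lawL_box_threeDefects_decide (hW : 5 ≤ h.1) (hE : h.1 + 6 ≤ m) (hS : 5 ≤ h.2) (hN : h.2 + 6 ≤ n) {c d e : Face}
    (hcF : (c.1 - (h.1 - 3), c.2 - (h.2 - 2)) ∉ apForced42) (hdF : (d.1 - (h.1 - 3), d.2 - (h.2 - 2)) ∉ apForced42)
    (heF : (e.1 - (h.1 - 3), e.2 - (h.2 - 2)) ∉ apForced42) (hh : h ∈ S) (hc : c ∈ S) (hd : d ∈ S) (he : e ∈ S)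
    (hSn : ∀ s ∈ S, s = h ∨ s = c ∨ s = d ∨ s = e)
    (hr : RootedFace (dom (boxMinus m n S)) (Face.side (h.1 + 1, h.2) .W) (farW (h.1 + 1, h.2))) :
    (PortTriple (c.1 - (h.1 - 3), c.2 - (h.2 - 2)) (d.1 - (h.1 - 3), d.2 - (h.2 - 2)) (e.1 - (h.1 - 3), e.2 - (h.2 - 2)) →
      ∀ θ ∈ Set.Icc (π / 3) (2 * π / 3),
        vertexFunctional (printedWeights θ) tFiveEighths (ybCoeff θ) (boxMinus m n S) (Face.side (h.1 + 1, h.2) .W)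
          (farW (h.1 + 1, h.2)) = 0) ∧
    (¬ PortTriple (c.1 - (h.1 - 3), c.2 - (h.2 - 2)) (d.1 - (h.1 - 3), d.2 - (h.2 - 2)) (e.1 - (h.1 - 3), e.2 - (h.2 - 2)) →
      ∀ θ : ℝ,
      (¬ ∀ (ω : ΩG (dom (boxMinus m n S)) (Face.side (h.1 + 1, h.2) .W) (farW (h.1 + 1, h.2))) (hb : ω.IsB2a),
          ω.2.firstSideG = .S → ω.WE (fun _ => θ) ≠ excursionWinding θ ω.2.firstSideG (ω.z1 hr hb) ω.1 →
            ¬ω.2.W2FreeOff (farW (h.1 + 1, h.2))) ∧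
      (¬ ∀ (ω : ΩG (dom (boxMinus m n S)) (Face.side (h.1 + 1, h.2) .W) (farW (h.1 + 1, h.2))) (hb : ω.IsB2a),
          ω.2.firstSideG = .N → ω.WE (fun _ => θ) ≠ excursionWinding θ ω.2.firstSideG (ω.z1 hr hb) ω.1 →
            ¬ω.2.W1FreeOff (farW (h.1 + 1, h.2))) ∧
      (¬ ∀ (ω : ΩG (dom (boxMinus m n S)) (Face.side (h.1 + 1, h.2) .W) (farW (h.1 + 1, h.2))) (hb : ω.IsB2a),
          ω.2.firstSideG = .S → ω.WE (fun _ => θ) ≠ excursionWinding θ ω.2.firstSideG (ω.z1 hr hb) ω.1 →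
            ¬ω.2.W1FreeOff (farW (h.1 + 1, h.2))) ∧
      (¬ ∀ (ω : ΩG (dom (boxMinus m n S)) (Face.side (h.1 + 1, h.2) .W) (farW (h.1 + 1, h.2))) (hb : ω.IsB2a),
          ω.2.firstSideG = .N → ω.WE (fun _ => θ) ≠ excursionWinding θ ω.2.firstSideG (ω.z1 hr hb) ω.1 →
            ¬ω.2.W2FreeOff (farW (h.1 + 1, h.2)))) := by
  refine ⟨fun hP θ hθ => ?_, fun hP θ => lawL_box_anyTriple_not_killed hW hE hS hN hcF hdF heF hP hSn hr θ⟩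
  -- the far cell is not removed: it is a forced cell and `S ⊆ {h, c, d, e}`
  have hfS : ((h.1 - 1, h.2) : Face) ∉ S := by
    intro hf
    rcases hSn _ hf with ef | ef | ef | ef
    · exact absurd (congrArg Prod.fst ef) (by simp)
    · apply hcF; rw [← ef]; simp [apForced42]
    · apply hdF; rw [← ef]; simp [apForced42]
    · apply heF; rw [← ef]; simp [apForced42]
  exact lawL_box_portTriple_vertexFunctional_eq_zero (by omega) (by omega) (by omega) (by omega) hh hfS hP hc hd he hθ
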